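import Literature.NumberTheory.Automorphic.ThorneQInfinityModularTheorem2Proofs
import Literature.NumberTheory.Automorphic.CaraianiNewtonResidualImageModularity
import Literature.NumberTheory.Automorphic.LanglandsTunnellModThree
import Literature.NumberTheory.Automorphic.StrongArtinGL2
import Literature.NumberTheory.Automorphic.HilbertResidualModularity
import HarnessLib

/-!
# Freitas–Le Hung–Siksek 2015, Theorem 3 at `p = 5`: the printed proof by Wiles' `3–5` modularity
# switching, formalised modulo its three printed inputs (proofs only)

Sibling PROOFS file (theorems only: no definition, no named fact; D-0014 / D-0026) of
`FLSResidualImageCriteria.lean`, home of the named fact `FLS2015_theorem3` (FLS 2015, Thm. 3: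
`p = 3` or `5`, `E / K` over a totally real field with `ρ̄_{E,p}(G_{K(ζ_p)})` absolutely irreducible
⇒ `E` modular), and of `ThorneQInfinityModularTheorem2Proofs.lean`, where the named fact
`Thorne2019_thm2_five` (Thorne 2019, Thm. 2, second alternative = Thorne 2016, Thm. 7.6) is proved
from FLS Thm. 3 at `p = 5` and Thorne 2016, Thm. 7.5 (`Thorne2019_thm2_five_of_liftingAtFive`).
This file goes one printed step further down: it proves the `p = 5` half of FLS Thm. 3 from the
three results its printed proof combines, so that both named facts are closed modulo PRIMITIVE
published inputs only (a modularity lifting theorem, the `p = 3` case = Langlands–Tunnell + lifting,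
the `3–5` switching lemma, and — for Thorne's theorem — the residually dihedral lifting theorem).

## The printed proof (held text `paper:arxiv-1310.7088`, read 2026-08-17)

N. Freitas, B. V. Le Hung, S. Siksek, *Elliptic curves over real quadratic fields are modular*,
Invent. Math. 201 (2015) 159–206 [FreitasLeHungSiksek2015]. Published section numbers are cited,
with the held-text (LaTeX source, numbering restarted in each Part) locator in brackets, as in
`FLSResidualImageCriteria.lean`.

* **Theorem 2** (§1, p. 4): "Let `E` be an elliptic curve over a totally real number field `K`,
  and let `p ≠ 2` be a rational prime. Write `ρ̄ = ρ̄_{E,p}`. Suppose (i) `ρ̄` is modular,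
  (ii) `ρ̄(G_{K(ζ_p)})` is absolutely irreducible. Then `E` is modular." (§2: "a relatively
  straightforward consequence of a theorem of Breuil and Diamond [Thm. 3.2.2], which in turn is a
  consequence of deep results due to Kisin, Gee, and Barnet-Lamb, Gee and Geraghty", with the
  repair of the Taylor–Wiles hypothesis at `p = 5` printed on p. 8 of the held text.)
* **Corollary 5.1** (§5; held text p. 11, "Corollary 4.1"): "If `E` is an elliptic curve over a
  totally real field `K` and `ρ̄_{E,3}(G_{K(ζ₃)})` is absolutely irreducible, then `E` is modular."
  ("an immediate corollary of Langlands–Tunnell [Thm. 6: `ρ̄_{E,3}` irreducible ⇒ `ρ̄_{E,3}`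
  modular, after Dieulefait–Freitas] and Theorem 2. It is of course Theorem 3 with `p = 3`.")
* **Lemma 6.1** (§6; held text p. 13, "Lemma 1.1"): "Let `E` be an elliptic curve over a number
  field `K`. Then there is an elliptic curve `E′/K` such that (i) `ρ̄_{E,5} ∼ ρ̄_{E′,5}`;
  (ii) `ρ̄_{E′,3}(G_K)` contains `SL₂(𝔽₃)`." (Proof: the twist `X_E(5) ≅ ℙ¹_K` of `X(5)` and
  Hilbert's irreducibility theorem — no carrier in the tree.)
* **Proof of Theorem 3 for `p = 5`** (§6; held text p. 13, verbatim): "Let `E` be an elliptic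
  curve over a totally real number field `K` and let `E′` be as in the statement of Lemma 6.1. It
  follows from Corollary 5.1 that `E′` is modular. Thus `ρ̄_{E,5} ∼ ρ̄_{E′,5}` is modular. Applying
  Theorem 2 to `E` with `p = 5`, we see that `E` is modular."

The one implicit step — Lemma 6.1 (ii) gives the hypothesis of Cor. 5.1 for `E′`, i.e.
`ρ̄_{E′,3}(G_K) ⊇ SL₂(𝔽₃)` implies `ρ̄_{E′,3}(G_{K(ζ₃)})` absolutely irreducible — is Prop. 4.1 (i)
of the source (`ρ̄(G_{K(ζ_p)}) = ρ̄(G_K) ∩ SL₂(𝔽_p)`) plus the absolute irreducibility of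
`SL₂(𝔽₃) ↷ 𝔽₃²`; it is the tree's theorem
`modPImageAbsIrreducibleOverCyclotomic_three_of_specialLinearGroup_le_range`
(`CaraianiNewtonResidualImageModularity.lean`, proved for every field of characteristic `0`).

## Rendering of the three inputs (hypotheses, written out in each theorem; NOT named facts)

All three are stated on the carriers of `FLS2015_theorem3` (`TotallyRealModularity.lean`,
"Rendering": an elliptic curve over `K` is an integral Weierstrass model `E / 𝓞 K` with `Δ(E) ≠ 0`,
"modular" is `IsAutomorphicOfWeightZero E`, `ρ̄_{E,p}` is any framing
`WeierstrassCurve.IsTorsionGaloisRep (E ⊗ K) p ρ̄` of the geometric `p`-torsion):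
* `h51` — Cor. 5.1 = `FLS2015_theorem3` sliced to `p = 3`, token for token.
* `h2` — Thm. 2 at `p = 5`, with hypothesis (i) "`ρ̄_{E,5}` is modular" in the form in which the
  printed proof of Thm. 3 supplies it ("`ρ̄_{E,5} ∼ ρ̄_{E′,5}` is modular" for a MODULAR elliptic
  curve `E′ / K`): some framing `ρ̄ : Γ_K → GL₂(𝔽₅)` is simultaneously a framing of `E[5]` and of
  `E′[5]` (an `𝔽₅[G_K]`-isomorphism `E[5] ≅ E′[5]` transports framings), and
  `IsAutomorphicOfWeightZero E′`. This is a special case of hypothesis (i) as printed (the source's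
  "ρ̄ modular" allows any Hilbert eigenform, `ρ̄_{E′,5}` of a modular `E′` being one instance), so
  `h2` is implied by, and no stronger than, Thm. 2.
* `h61` — Lemma 6.1 for (integral models of) elliptic curves over number fields: (i) as the common
  framing above, (ii) "`ρ̄_{E′,3}(G_K)` contains `SL₂(𝔽₃)`" for some (equivalently every: framings
  are conjugate, `SL₂ = ker det` is normal) framing of `E′[3]`, spelled as in the hypothesis of
  `modPImageAbsIrreducibleOverCyclotomic_three_of_specialLinearGroup_le_range` and of the tree's
  `ℚ`-analogue `BCDT.exists_isTorsionGaloisRep_five_and_surjective_three` (`BCDTTheoremB.lean`).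
None of the three has a carrier in Mathlib or `Literature` (modularity lifting over totally real
fields; Langlands–Tunnell for `ρ̄_{E,3}` over totally real `K`; `X_E(5)` and Hilbert
irreducibility), and D-0026 forbids minting them here; every theorem below is a reduction, not a
discharge.

## What this file proves

* `FLS2015.theorem3_five_of_switching` — Thm. 3 at `p = 5` from `h51`, `h2`, `h61`: the printed
  proof, verbatim (`E′` from Lemma 6.1; `E′` modular by Cor. 5.1 through
  `modPImageAbsIrreducibleOverCyclotomic_three_of_specialLinearGroup_le_range`; Thm. 2 at `p = 5`).
* `FLS2015_theorem3_of_corollary5_1_of_switching` — the whole named fact `FLS2015_theorem3`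
  (`p = 3 ∨ p = 5`) from the same three inputs (the `p = 3` disjunct IS `h51`).
* `Thorne2016_theorem7_6_of_switching_of_dihedralLifting`,
  `Thorne2019_thm2_five_of_switching_of_dihedralLifting` — Thorne 2016, Thm. 7.6 and the named fact
  `Thorne2019_thm2_five` from `h51`, `h2`, `h61` and Thorne 2016, Thm. 7.5 for `ρ_{E,5}` (`hT`,
  exactly the binder of `Thorne2019_thm2_five_of_liftingAtFive`), by feeding
  `FLS2015.theorem3_five_of_switching` to `Thorne2016_theorem7_6_of_liftingAtFive`: the complete
  printed proof of Thorne 2019, Thm. 2 (second alternative) down to its four primitive published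
  inputs — "results of Kisin [Thm. 2] and Langlands–Tunnell [Cor. 5.1] … the 3–5 switch of Wiles
  [Lemma 6.1] … [Tho15] [Thm. 7.5]" (Thorne 2019, proof of Thm. 2, p. 4 of the held text
  `paper:arxiv-1505.04769`).
* `FLS2015.exists_isPiOfArtinRep_modThreeLift`,
  `WeierstrassCurve.exists_isPiOfArtinRep_modThreeLift_of_strongArtin` — one printed step INSIDE
  the input `h51`: the Langlands–Tunnell input of **Theorem 6** (§5; held text p. 11: "Let `E` be
  an elliptic curve over a totally real number field `K` and suppose `ρ̄_{E,3}` is irreducible. Then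
  `ρ̄_{E,3}` is modular. The deduction of Theorem 6 from the Langlands–Tunnell Theorem [Langlands],
  [Tunnell] is well-known; a proof is given by Dieulefait and Freitas in [DF2] and follows the
  lines of the argument by Wiles [Wiles] for classical modular forms") from the tree's EXISTING
  named fact `strongArtin_of_isSolvable` (`StrongArtinGL2.lean`: Langlands 1980 + Tunnell 1981 over
  any number field, Gelbart 1997 Thm. 2.1): for `E / K` (`K` totally real) with `ρ̄_{E,3}`
  irreducible, the complex lift `σ = Ψ ∘ ρ̄_{E,3} : Γ_K → GL₂(ℤ[√-2]) ⊂ GL₂(ℂ)` (the tree's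
  `modThreeLift`, Wiles' Step 1; odd, solvable and irreducible by `LanglandsTunnellModThree`,
  Steps 1–2, proved there for every base field) is attached to a cuspidal automorphic
  representation `π(σ)` of `GL₂(𝔸_K)` (`IsPiOfArtinRep σ π`).  This is where the cone of
  `FLS2015_theorem3` meets the Langlands–Tunnell debt of the tree: Thm. 3 at `p = 3` IS Cor. 5.1 =
  Thm. 6 + Thm. 2, and Thm. 3 at `p = 5` uses Cor. 5.1 for `E′`; the remaining printed content of
  Thm. 6 (weight one → parallel weight two: Eisenstein series `≡ 1 (mod 3)` and the Deligne–Serre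
  lemma over `K`, [DF2]) and Thm. 2 itself have no carrier and are NOT restated (D-0026).
  `FLS2015_theorem3_of_strongArtin_of_liftingAtThree_of_switching` and
  `Thorne2019_thm2_five_of_strongArtin_of_liftingAtThree_of_switching_of_dihedralLifting` are the
  two assemblies above with `h51` split at that seam: the Langlands–Tunnell step discharged from
  `strongArtin_of_isSolvable`, the rest of Cor. 5.1 kept as the hypothesis `h3`.
* `FLS2015_theorems3_4_iff` (with `FLS2015_theorem3_of_theorems3_4`,
  `FLS2015_theorem4_of_theorems3_4`, `FLS2015_theorems3_4_of_theorem3_of_theorem4`) — the joint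
  carrier `FLS2015_theorems3_4` of `FreitasLeHungSiksekLifting.lean` (`p ∈ {3, 5, 7}`) is
  equivalent to `FLS2015_theorem3 ∧ FLS2015_theorem4`: the same printed theorems vendored twice on
  the same carriers, linked so that the debt is one;
  `FLS2015_theorems3_4_of_strongArtin_of_liftingAtThree_of_switching_of_theorem4` closes the joint
  carrier modulo the primitive inputs above and `FLS2015_theorem4`.
* `FLS2015.corollary5_1_of_theorem6_of_theorem2`, `FLS2015.liftingAtFive_of_theorem2`,
  `FLS2015_theorem3_of_theorem6_of_theorem2_of_switching`,
  `FLS2015_theorem3_of_strongArtin_of_weightTwo_of_theorem2_of_switching`,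
  `Thorne2019_thm2_five_of_theorem6_of_theorem2_of_switching_of_dihedralLifting` — the same
  assemblies with the two lifting inputs written AS PRINTED on the carrier
  `ModPGaloisRep.IsHilbertModular` ("`ρ̄` is modular", §1 of the source;
  `HilbertResidualModularity.lean`): **Theorem 6** ("`ρ̄_{E,3}` irreducible ⇒ `ρ̄_{E,3}` is
  modular") and **Theorem 2** ("`p ≠ 2`, (i) `ρ̄` modular, (ii) `ρ̄(G_{K(ζ_p)})` absolutely
  irreducible ⇒ `E` modular").  Cor. 5.1 is Thm. 6 + Thm. 2 at `p = 3` (this IS `h51`), and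
  Thm. 2 implies the form `h2` used by the switch because the `5`-torsion of a modular `E′` is
  modular (`WeierstrassCurve.IsTorsionGaloisRep.isHilbertModular`, proved there: "Thus
  `ρ̄_{E,5} ∼ ρ̄_{E′,5}` is modular") and framings are conjugate; so every assembly above is
  reachable from the verbatim theorems, and Thm. 6 splits at its Langlands–Tunnell seam into the
  existing fact `strongArtin_of_isSolvable` (discharged step) and the weight-two step `hW2` of [DF2].

## References

* [FreitasLeHungSiksek2015] Invent. Math. 201 (2015) 159–206, Thm. 2 (§1 p. 4, §2), Thm. 3,
  Cor. 5.1 (§5), Lemma 6.1 and the proof of Thm. 3 for `p = 5` (§6) — held `paper:arxiv-1310.7088`,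
  pp. 4, 8, 11, 13 of the text (held-text numbers: Cor. 4.1, Lemma 1.1).
* [Thorne2019] J. Eur. Math. Soc. 21 (2019), Thm. 2 and its proof (p. 4 of `paper:arxiv-1505.04769`).
* [Thorne2016] Math. Ann. 364 (2016), Thms. 7.5, 7.6 (pp. 36–37 of `paper:arxiv-1504.00994`).
* [CaraianiNewton2023] §6.1 p. 88 (the remark `SL₂ ⊆ image ⇒ absolutely irreducible over the
  cyclotomic field`; tree: `modPImageAbsIrreducibleOverCyclotomic_three_of_specialLinearGroup_le_range`).
* [Gelbart1997] S. Gelbart, *Three lectures on the modularity of `ρ̄_{E,3}` …*, in Modular Forms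
  and Fermat's Last Theorem (1997), Thm. 2.1 (Langlands–Tunnell over a number field `F`) and §1.4,
  Prop. 1.4, Steps 1–2 (tree: `strongArtin_of_isSolvable`, `modThreeLift`).
* [Wiles1995Annals] A. Wiles, Ann. of Math. 141 (1995), Ch. 5 (the argument [DF2] transposes to `K`).
-/

open scoped NumberField MatrixGroups
open NumberField Field Matrix Literature.NumberTheory.GaloisRepresentations

noncomputable section

namespace Literature.NumberTheory.Automorphic

/-! ## FLS Theorem 3 at `p = 5` from Cor. 5.1, Thm. 2 and Lemma 6.1 -/

/-- **Freitas–Le Hung–Siksek 2015, Thm. 3 for `p = 5`, by the printed `3–5` switching argument.**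
Hypotheses (module docstring, "Rendering"): `h51` = Cor. 5.1 (Thm. 3 at `p = 3`); `h2` = Thm. 2 at
`p = 5` with (i) in the form "`E[5] ≅ E′[5]` for a modular `E′`"; `h61` = Lemma 6.1. Conclusion:
for `K` totally real, `E / 𝓞 K` with `Δ ≠ 0`, `p = 5` and `ρ̄_{E,5}(G_{K(ζ₅)})` absolutely
irreducible (`ModPImageAbsIrreducibleOverCyclotomic`), `E` is automorphic of weight zero. Proof,
verbatim from §6: take `E′` from Lemma 6.1; by (ii) and
`modPImageAbsIrreducibleOverCyclotomic_three_of_specialLinearGroup_le_range`,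
`ρ̄_{E′,3}(G_{K(ζ₃)})` is absolutely irreducible, so `E′` is modular by Cor. 5.1; thus `ρ̄_{E,5}`
(`≅ ρ̄_{E′,5}` by (i)) is modular and Thm. 2 at `p = 5` applies to `E`.
[cite: FreitasLeHungSiksek2015, Thm. 3 and its proof for p = 5 (§6), Thm. 2, Cor. 5.1, Lemma 6.1] -/
theorem FLS2015.theorem3_five_of_switching
    (h51 : ∀ (K : Type) [Field K] [NumberField K] [IsTotallyReal K] (E : WeierstrassCurve (𝓞 K)),
      E.Δ ≠ 0 → ∀ (p : ℕ) [Fact p.Prime], p = 3 →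
        ModPImageAbsIrreducibleOverCyclotomic (E.baseChange K) p → IsAutomorphicOfWeightZero E)
    (h2 : ∀ (K : Type) [Field K] [NumberField K] [IsTotallyReal K] (E : WeierstrassCurve (𝓞 K)),
      E.Δ ≠ 0 → ∀ (p : ℕ) [Fact p.Prime], p = 5 →
        (∃ E' : WeierstrassCurve (𝓞 K), E'.Δ ≠ 0 ∧ IsAutomorphicOfWeightZero E' ∧
          ∃ ρ : ModPGaloisRep K (ZMod p) 2,
            (E.baseChange K).IsTorsionGaloisRep p ρ ∧ (E'.baseChange K).IsTorsionGaloisRep p ρ) →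
        ModPImageAbsIrreducibleOverCyclotomic (E.baseChange K) p → IsAutomorphicOfWeightZero E)
    (h61 : ∀ (K : Type) [Field K] [NumberField K] (E : WeierstrassCurve (𝓞 K)), E.Δ ≠ 0 →
      ∃ E' : WeierstrassCurve (𝓞 K), E'.Δ ≠ 0 ∧
        (∃ ρ : ModPGaloisRep K (ZMod 5) 2,
          (E.baseChange K).IsTorsionGaloisRep 5 ρ ∧ (E'.baseChange K).IsTorsionGaloisRep 5 ρ) ∧
        ∃ ρ₃ : FramedGaloisRep K (ZMod 3) 2, (E'.baseChange K).IsTorsionGaloisRep 3 ρ₃ ∧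
          ∀ g : Matrix.SpecialLinearGroup (Fin 2) (ZMod 3), ∃ σ,
            ρ₃ σ = Matrix.SpecialLinearGroup.toGL g)
    (K : Type) [Field K] [NumberField K] [IsTotallyReal K] (E : WeierstrassCurve (𝓞 K))
    (hΔ : E.Δ ≠ 0) (p : ℕ) [Fact p.Prime] (hp : p = 5)
    (himg : ModPImageAbsIrreducibleOverCyclotomic (E.baseChange K) p) :
    IsAutomorphicOfWeightZero E := by
  subst hp
  -- "let `E′` be as in the statement of Lemma 6.1"
  obtain ⟨E', hΔ', h5, ρ₃, hρ₃, hSL⟩ := h61 K E hΔ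
  haveI := FLS2015.isElliptic_baseChange hΔ'
  -- Lemma 6.1 (ii) gives the hypothesis of Cor. 5.1 for `E′` (Prop. 4.1 (i) + `SL₂(𝔽₃)` abs. irr.)
  have himg' : ModPImageAbsIrreducibleOverCyclotomic (E'.baseChange K) 3 :=
    modPImageAbsIrreducibleOverCyclotomic_three_of_specialLinearGroup_le_range (E'.baseChange K)
      ⟨ρ₃, hρ₃, hSL⟩
  -- "It follows from Corollary 5.1 that `E′` is modular."
  have hE' : IsAutomorphicOfWeightZero E' := h51 K E' hΔ' 3 rfl himg'
  -- "Thus `ρ̄_{E,5} ∼ ρ̄_{E′,5}` is modular. Applying Theorem 2 to `E` with `p = 5` …"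
  exact h2 K E hΔ 5 rfl ⟨E', hΔ', hE', h5⟩ himg

/-- **The named fact `FLS2015_theorem3` (`p = 3 ∨ p = 5`) from Cor. 5.1, Thm. 2 at `p = 5` and
Lemma 6.1**: the `p = 3` disjunct is Cor. 5.1 itself ("It is of course Theorem 3 with `p = 3`"),
the `p = 5` disjunct is `FLS2015.theorem3_five_of_switching`. A reduction, not a discharge: the
three hypotheses have no carrier in the tree (module docstring).
[cite: FreitasLeHungSiksek2015, Thm. 3 (proof: Cor. 5.1 for p = 3, §6 for p = 5)] -/
theorem FLS2015_theorem3_of_corollary5_1_of_switching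
    (h51 : ∀ (K : Type) [Field K] [NumberField K] [IsTotallyReal K] (E : WeierstrassCurve (𝓞 K)),
      E.Δ ≠ 0 → ∀ (p : ℕ) [Fact p.Prime], p = 3 →
        ModPImageAbsIrreducibleOverCyclotomic (E.baseChange K) p → IsAutomorphicOfWeightZero E)
    (h2 : ∀ (K : Type) [Field K] [NumberField K] [IsTotallyReal K] (E : WeierstrassCurve (𝓞 K)),
      E.Δ ≠ 0 → ∀ (p : ℕ) [Fact p.Prime], p = 5 →
        (∃ E' : WeierstrassCurve (𝓞 K), E'.Δ ≠ 0 ∧ IsAutomorphicOfWeightZero E' ∧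
          ∃ ρ : ModPGaloisRep K (ZMod p) 2,
            (E.baseChange K).IsTorsionGaloisRep p ρ ∧ (E'.baseChange K).IsTorsionGaloisRep p ρ) →
        ModPImageAbsIrreducibleOverCyclotomic (E.baseChange K) p → IsAutomorphicOfWeightZero E)
    (h61 : ∀ (K : Type) [Field K] [NumberField K] (E : WeierstrassCurve (𝓞 K)), E.Δ ≠ 0 →
      ∃ E' : WeierstrassCurve (𝓞 K), E'.Δ ≠ 0 ∧
        (∃ ρ : ModPGaloisRep K (ZMod 5) 2,
          (E.baseChange K).IsTorsionGaloisRep 5 ρ ∧ (E'.baseChange K).IsTorsionGaloisRep 5 ρ) ∧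
        ∃ ρ₃ : FramedGaloisRep K (ZMod 3) 2, (E'.baseChange K).IsTorsionGaloisRep 3 ρ₃ ∧
          ∀ g : Matrix.SpecialLinearGroup (Fin 2) (ZMod 3), ∃ σ,
            ρ₃ σ = Matrix.SpecialLinearGroup.toGL g) :
    FLS2015_theorem3 := by
  intro K _ _ _ E hΔ p _ hp himg
  rcases hp with hp | hp
  · exact h51 K E hΔ p hp himg
  · exact FLS2015.theorem3_five_of_switching h51 h2 h61 K E hΔ p hp himg

/-! ## Thorne 2016, Thm. 7.6 and `Thorne2019_thm2_five` down to their four primitive inputs -/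

/-- **Thorne 2016, Thm. 7.6 from Cor. 5.1, Thm. 2 at `p = 5`, Lemma 6.1 (FLS 2015) and Thm. 7.5
(Thorne 2016).** For `F` totally real with `√5 ∉ F` and `E / 𝓞 F` with `Δ ≠ 0` and `E[5]`
irreducible, `E` is automorphic of weight zero — the printed proof of Thm. 7.6
(`Thorne2016_theorem7_6_of_liftingAtFive`: first case [Fre13] = FLS Thm. 3 at `p = 5`, second case
Thm. 7.5 for `ρ_{E,5}`, binder `hT` verbatim from that theorem) with its first case unfolded one
printed step further by `FLS2015.theorem3_five_of_switching`. All four hypotheses are primitive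
published lifting / switching theorems without carrier in the tree (module docstring).
[cite: Thorne2016, Thm. 7.6 and its proof, Thm. 7.5]
[cite: FreitasLeHungSiksek2015, Thm. 2, Cor. 5.1, Lemma 6.1, proof of Thm. 3 for p = 5] -/
theorem Thorne2016_theorem7_6_of_switching_of_dihedralLifting
    (h51 : ∀ (K : Type) [Field K] [NumberField K] [IsTotallyReal K] (E : WeierstrassCurve (𝓞 K)),
      E.Δ ≠ 0 → ∀ (p : ℕ) [Fact p.Prime], p = 3 →
        ModPImageAbsIrreducibleOverCyclotomic (E.baseChange K) p → IsAutomorphicOfWeightZero E)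
    (h2 : ∀ (K : Type) [Field K] [NumberField K] [IsTotallyReal K] (E : WeierstrassCurve (𝓞 K)),
      E.Δ ≠ 0 → ∀ (p : ℕ) [Fact p.Prime], p = 5 →
        (∃ E' : WeierstrassCurve (𝓞 K), E'.Δ ≠ 0 ∧ IsAutomorphicOfWeightZero E' ∧
          ∃ ρ : ModPGaloisRep K (ZMod p) 2,
            (E.baseChange K).IsTorsionGaloisRep p ρ ∧ (E'.baseChange K).IsTorsionGaloisRep p ρ) →
        ModPImageAbsIrreducibleOverCyclotomic (E.baseChange K) p → IsAutomorphicOfWeightZero E)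
    (h61 : ∀ (K : Type) [Field K] [NumberField K] (E : WeierstrassCurve (𝓞 K)), E.Δ ≠ 0 →
      ∃ E' : WeierstrassCurve (𝓞 K), E'.Δ ≠ 0 ∧
        (∃ ρ : ModPGaloisRep K (ZMod 5) 2,
          (E.baseChange K).IsTorsionGaloisRep 5 ρ ∧ (E'.baseChange K).IsTorsionGaloisRep 5 ρ) ∧
        ∃ ρ₃ : FramedGaloisRep K (ZMod 3) 2, (E'.baseChange K).IsTorsionGaloisRep 3 ρ₃ ∧
          ∀ g : Matrix.SpecialLinearGroup (Fin 2) (ZMod 3), ∃ σ,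
            ρ₃ σ = Matrix.SpecialLinearGroup.toGL g)
    (hT : ∀ (F : Type) [Field F] [NumberField F] [IsTotallyReal F], ¬ IsSquare (5 : F) →
      ∀ (p : ℕ) [Fact p.Prime], p = 5 →
        ∀ (E : WeierstrassCurve (𝓞 F)), E.Δ ≠ 0 → (E.baseChange F).HasIrreducibleModPGaloisRep 5 →
          ∀ ρ : ModPGaloisRep F (ZMod p) 2, (E.baseChange F).IsTorsionGaloisRep p ρ →
            FramedRep.IsAbsolutelyIrreducible ρ →
            (∀ σ, Matrix.GeneralLinearGroup.det (ρ σ) = modPCyclotomicCharacterZMod F p σ) →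
            ∀ (L : Type) [Field L] [Algebra F L] [IsCyclotomicExtension {p} F L],
              ¬ FramedRep.IsAbsolutelyIrreducible (FramedGaloisRep.restrictField L ρ) →
              (∃ (k : Type) (_ : Field k) (f : ZMod p →+* k) (Q : GL (Fin 2) k),
                  (∀ τ : absoluteGaloisGroup L,
                    Q * Matrix.GeneralLinearGroup.map f (FramedGaloisRep.restrictField L ρ τ) *
                      Q⁻¹ ∈ Serre1972.diagonalSubgroup k) ∧
                  ∃ τ : absoluteGaloisGroup L,
                    ((Q * Matrix.GeneralLinearGroup.map f (FramedGaloisRep.restrictField L ρ τ) *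
                        Q⁻¹ : GL (Fin 2) k) : Matrix (Fin 2) (Fin 2) k) 0 0 ≠
                      ((Q * Matrix.GeneralLinearGroup.map f (FramedGaloisRep.restrictField L ρ τ) *
                        Q⁻¹ : GL (Fin 2) k) : Matrix (Fin 2) (Fin 2) k) 1 1) →
              (∃ (M : Type) (_ : Field M) (_ : Algebra F M),
                  Module.finrank F M = 2 ∧ IsTotallyReal M ∧ Nonempty (M →ₐ[F] L)) →
              IsAutomorphicOfWeightZero E)
    (F : Type) [Field F] [NumberField F] [IsTotallyReal F] (h5 : ¬ IsSquare (5 : F))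
    (E : WeierstrassCurve (𝓞 F)) (hΔ : E.Δ ≠ 0)
    (hirr : (E.baseChange F).HasIrreducibleModPGaloisRep 5) : IsAutomorphicOfWeightZero E :=
  Thorne2016_theorem7_6_of_liftingAtFive
    (fun K _ _ _ _ E hΔ _ p _ hp himg => FLS2015.theorem3_five_of_switching h51 h2 h61 K E hΔ p hp himg)
    hT F h5 E hΔ hirr

/-- **`Thorne2019_thm2_five` from its four primitive printed inputs**: FLS 2015 Cor. 5.1
(Langlands–Tunnell + lifting at `p = 3`), Thm. 2 at `p = 5` (modularity lifting, (i) in the form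
"`E[5] ≅ E′[5]` for a modular `E′`"), Lemma 6.1 (`3–5` switching), and Thorne 2016 Thm. 7.5 for
`ρ_{E,5}` (residually dihedral lifting, binder `hT` of `Thorne2019_thm2_five_of_liftingAtFive`).
This is the proof printed by Thorne 2019 for Thm. 2, second alternative — "results of Kisin and
Langlands–Tunnell, see [Fre13] … the 3–5 switch of Wiles, described in loc. cit. … [Tho15]" —
with every piece of glue proved in the tree (this file, `ThorneQInfinityModularTheorem2Proofs`).
Once carriers of the four inputs and their `_holds` exist, `Thorne2019_thm2_five_holds` is this
theorem applied to them (by specialisation of whatever phrasing they take).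
[cite: Thorne2019, Thm. 2 and its proof] [cite: Thorne2016, Thms. 7.5, 7.6]
[cite: FreitasLeHungSiksek2015, Thm. 2, Cor. 5.1, Lemma 6.1, proof of Thm. 3 for p = 5] -/
theorem Thorne2019_thm2_five_of_switching_of_dihedralLifting
    (h51 : ∀ (K : Type) [Field K] [NumberField K] [IsTotallyReal K] (E : WeierstrassCurve (𝓞 K)),
      E.Δ ≠ 0 → ∀ (p : ℕ) [Fact p.Prime], p = 3 →
        ModPImageAbsIrreducibleOverCyclotomic (E.baseChange K) p → IsAutomorphicOfWeightZero E)
    (h2 : ∀ (K : Type) [Field K] [NumberField K] [IsTotallyReal K] (E : WeierstrassCurve (𝓞 K)),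
      E.Δ ≠ 0 → ∀ (p : ℕ) [Fact p.Prime], p = 5 →
        (∃ E' : WeierstrassCurve (𝓞 K), E'.Δ ≠ 0 ∧ IsAutomorphicOfWeightZero E' ∧
          ∃ ρ : ModPGaloisRep K (ZMod p) 2,
            (E.baseChange K).IsTorsionGaloisRep p ρ ∧ (E'.baseChange K).IsTorsionGaloisRep p ρ) →
        ModPImageAbsIrreducibleOverCyclotomic (E.baseChange K) p → IsAutomorphicOfWeightZero E)
    (h61 : ∀ (K : Type) [Field K] [NumberField K] (E : WeierstrassCurve (𝓞 K)), E.Δ ≠ 0 →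
      ∃ E' : WeierstrassCurve (𝓞 K), E'.Δ ≠ 0 ∧
        (∃ ρ : ModPGaloisRep K (ZMod 5) 2,
          (E.baseChange K).IsTorsionGaloisRep 5 ρ ∧ (E'.baseChange K).IsTorsionGaloisRep 5 ρ) ∧
        ∃ ρ₃ : FramedGaloisRep K (ZMod 3) 2, (E'.baseChange K).IsTorsionGaloisRep 3 ρ₃ ∧
          ∀ g : Matrix.SpecialLinearGroup (Fin 2) (ZMod 3), ∃ σ,
            ρ₃ σ = Matrix.SpecialLinearGroup.toGL g)
    (hT : ∀ (F : Type) [Field F] [NumberField F] [IsTotallyReal F], ¬ IsSquare (5 : F) →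
      ∀ (p : ℕ) [Fact p.Prime], p = 5 →
        ∀ (E : WeierstrassCurve (𝓞 F)), E.Δ ≠ 0 → (E.baseChange F).HasIrreducibleModPGaloisRep 5 →
          ∀ ρ : ModPGaloisRep F (ZMod p) 2, (E.baseChange F).IsTorsionGaloisRep p ρ →
            FramedRep.IsAbsolutelyIrreducible ρ →
            (∀ σ, Matrix.GeneralLinearGroup.det (ρ σ) = modPCyclotomicCharacterZMod F p σ) →
            ∀ (L : Type) [Field L] [Algebra F L] [IsCyclotomicExtension {p} F L],
              ¬ FramedRep.IsAbsolutelyIrreducible (FramedGaloisRep.restrictField L ρ) →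
              (∃ (k : Type) (_ : Field k) (f : ZMod p →+* k) (Q : GL (Fin 2) k),
                  (∀ τ : absoluteGaloisGroup L,
                    Q * Matrix.GeneralLinearGroup.map f (FramedGaloisRep.restrictField L ρ τ) *
                      Q⁻¹ ∈ Serre1972.diagonalSubgroup k) ∧
                  ∃ τ : absoluteGaloisGroup L,
                    ((Q * Matrix.GeneralLinearGroup.map f (FramedGaloisRep.restrictField L ρ τ) *
                        Q⁻¹ : GL (Fin 2) k) : Matrix (Fin 2) (Fin 2) k) 0 0 ≠
                      ((Q * Matrix.GeneralLinearGroup.map f (FramedGaloisRep.restrictField L ρ τ) *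
                        Q⁻¹ : GL (Fin 2) k) : Matrix (Fin 2) (Fin 2) k) 1 1) →
              (∃ (M : Type) (_ : Field M) (_ : Algebra F M),
                  Module.finrank F M = 2 ∧ IsTotallyReal M ∧ Nonempty (M →ₐ[F] L)) →
              IsAutomorphicOfWeightZero E) :
    Thorne2019_thm2_five :=
  Thorne2019_thm2_five_of_liftingAtFive
    (fun K _ _ _ _ E hΔ _ p _ hp himg => FLS2015.theorem3_five_of_switching h51 h2 h61 K E hΔ p hp himg)
    hT

/-! ## Inside `h51`: the Langlands–Tunnell input of Theorem 6 over `K`, from the existing named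
fact `strongArtin_of_isSolvable`

FLS Thm. 6 (§5) — "`ρ̄_{E,3}` irreducible ⇒ `ρ̄_{E,3}` modular" for `E` over a totally real `K` — is
deduced in print from the Langlands–Tunnell theorem over `K` ([Langlands], [Tunnell]; [DF2] following
Wiles, Ch. 5): Step 1, lift `ρ̄_{E,3}` along `Ψ : GL₂(𝔽₃) ↪ GL₂(ℤ[√-2]) ⊂ GL₂(ℂ)`; Step 2, the lift
`σ` is odd, irreducible and has solvable image; Step 3, Langlands–Tunnell attaches to `σ` a cuspidal
automorphic representation `π(σ)` of `GL₂(𝔸_K)` (a Hilbert eigenform of parallel weight one); then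
the weight is raised to two.  Steps 1–2 are theorems of the tree for every base field
(`LanglandsTunnellModThree`); Step 3 over `K` is exactly the tree's named fact
`strongArtin_of_isSolvable` (`StrongArtinGL2`), taken here as the hypothesis `hSA`.  The weight
shift and Thm. 2 are not restated. -/

/-- **Langlands–Tunnell applies to the complex lift of an absolutely irreducible
`ρ̄ : Γ_K → GL₂(𝔽₃)` over any number field `K`** (Wiles' Steps 1–3 transposed to `K`, as in FLS
2015 §5 / Dieulefait–Freitas): granted the strong Artin conjecture for solvable two-dimensional
representations over number fields (`strongArtin_of_isSolvable`: Langlands 1980, Tunnell 1981;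
Gelbart 1997, Thm. 2.1), the lift `σ = Ψ ∘ ρ̄` (`modThreeLift ρ̄`) — irreducible
(`isIrreducible_modThreeLift`) with solvable image (`isSolvable_range_modThreeLift`, hence solvable
projective image, `isSolvable_projectiveImage_iff`) — is attached to a cuspidal automorphic
representation of `GL₂(𝔸_K)`: `π = π(σ)` in Tunnell's sense (`IsPiOfArtinRep`: `t_{π_v} ∼ σ(Frob_v)`
at almost all `v`).  [cite: FreitasLeHungSiksek2015, §5 (Thm. 6 and its deduction from Langlands–Tunnell)]
[cite: Gelbart1997, Thm. 2.1 and §1.4 Steps 1–3] -/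
theorem FLS2015.exists_isPiOfArtinRep_modThreeLift (hSA : strongArtin_of_isSolvable)
    {K : Type} [Field K] [NumberField K] (ρ : ModPGaloisRep K (ZMod 3) 2)
    (habs : FramedRep.IsAbsolutelyIrreducible ρ) :
    ∃ (hcpt : isCompact_glFiniteIntegralLevel 2 K) (π : CuspidalAutomorphicRepData 2 K hcpt),
      IsPiOfArtinRep (modThreeLift ρ) π.1 :=
  hSA (modThreeLift ρ)
    ((FramedRep.isIrreducible_toContinuousRep_iff _).mpr (isIrreducible_modThreeLift habs))
    ((isSolvable_projectiveImage_iff _).mpr (isSolvable_range_modThreeLift ρ))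

/-- **FLS 2015, Theorem 6, Langlands–Tunnell input: for an elliptic curve `E` over a totally real
field `K` with `ρ̄_{E,3}` irreducible, `π(Ψ ∘ ρ̄_{E,3})` exists on `GL₂(𝔸_K)`** (granted
`strongArtin_of_isSolvable`).  Here `ρ̄` is any framing of the Galois action on `E[3]`
(`IsTorsionGaloisRep`); it is odd because `det ρ̄ = χ̄₃` (Weil pairing, the tree's
`det_eq_modPCyclotomicCharacter_of_isTorsionGaloisRep_holds`) and `χ̄₃(c) = -1` at the complex
conjugations of a real place (`modNCyclotomicCharacter_of_isComplexConjugation`; `K` totally real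
has one, `FLS2015.exists_realEmbedding`), hence absolutely irreducible
(`FramedGaloisRep.IsOdd.isAbsolutelyIrreducible`, `3 ≠ 2`), and
`FLS2015.exists_isPiOfArtinRep_modThreeLift` applies.  What Thm. 6 prints beyond this — a Hilbert
eigenform of PARALLEL WEIGHT TWO congruent to `ρ̄_{E,3}` — is the weight shift of [DF2] and is not
claimed.  Deliberate dot-notation extension of Mathlib's `WeierstrassCurve`.
[cite: FreitasLeHungSiksek2015, Thm. 6 (§5)] [cite: Gelbart1997, Prop. 1.4, Steps 1–3] -/
theorem _root_.WeierstrassCurve.exists_isPiOfArtinRep_modThreeLift_of_strongArtin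
    (hSA : strongArtin_of_isSolvable) {K : Type} [Field K] [NumberField K] [IsTotallyReal K]
    (W : WeierstrassCurve K) [W.IsElliptic] {ρ : ModPGaloisRep K (ZMod 3) 2}
    (hρ : W.IsTorsionGaloisRep 3 ρ) (hirr : FramedRep.IsIrreducible ρ) :
    ∃ (hcpt : isCompact_glFiniteIntegralLevel 2 K) (π : CuspidalAutomorphicRepData 2 K hcpt),
      IsPiOfArtinRep (modThreeLift ρ) π.1 := by
  haveI : NeZero ((3 : ℕ) : K) := NeZero.charZero
  obtain ⟨φ⟩ := FLS2015.exists_realEmbedding K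
  have hodd : FramedGaloisRep.IsOdd ρ := by
    intro φ' c hc
    rw [W.det_eq_modPCyclotomicCharacter_of_isTorsionGaloisRep_holds 3 ρ hρ c]
    ext
    rw [modPCyclotomicCharacterZMod_eq_modNCyclotomicCharacter,
      modNCyclotomicCharacter_of_isComplexConjugation hc, Units.val_neg, Units.val_one]
  exact FLS2015.exists_isPiOfArtinRep_modThreeLift hSA ρ
    (hodd.isAbsolutelyIrreducible φ hirr (by decide))

/-- **`FLS2015_theorem3` closed modulo the existing fact `strongArtin_of_isSolvable` and three
carrier-less printed inputs.**  Same as `FLS2015_theorem3_of_corollary5_1_of_switching`, with the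
input `h51` (Cor. 5.1 = Thm. 6 + Thm. 2 at `p = 3`) split at the one seam the tree can express:
its Langlands–Tunnell step is DISCHARGED from `hSA : strongArtin_of_isSolvable` through
`FLS2015.exists_isPiOfArtinRep_modThreeLift` (every framing `ρ̄` of `E[3]` is absolutely
irreducible under the image hypothesis, `ModPImageAbsIrreducibleOverCyclotomic.isAbsolutelyIrreducible`),
and what remains of Cor. 5.1 is the hypothesis `h3` — for `E / 𝓞 K` (`K` totally real, `Δ ≠ 0`)
such that `π(Ψ ∘ ρ̄)` exists on `GL₂(𝔸_K)` for every framing `ρ̄` of `E[3]` and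
`ρ̄_{E,3}(G_{K(ζ₃)})` is absolutely irreducible, `E` is modular: in print, the weight shift of
Thm. 6 ([DF2]: weight-one `π(σ)` ⇝ parallel-weight-two eigenform congruent to `ρ̄_{E,3}`, i.e.
"`ρ̄_{E,3}` is modular") followed by Thm. 2 at `p = 3`.  `h3` is implied by Cor. 5.1 (it has one
hypothesis more) and, like `h2`, `h61`, has no carrier in the tree; none is a named fact (D-0026).
[cite: FreitasLeHungSiksek2015, Thm. 3 (proof), Cor. 5.1, Thm. 6 (§5), Thm. 2, Lemma 6.1]
[cite: Gelbart1997, Thm. 2.1] -/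
theorem FLS2015_theorem3_of_strongArtin_of_liftingAtThree_of_switching
    (hSA : strongArtin_of_isSolvable)
    (h3 : ∀ (K : Type) [Field K] [NumberField K] [IsTotallyReal K] (E : WeierstrassCurve (𝓞 K)),
      E.Δ ≠ 0 →
        (∀ ρ : ModPGaloisRep K (ZMod 3) 2, (E.baseChange K).IsTorsionGaloisRep 3 ρ →
          ∃ (hcpt : isCompact_glFiniteIntegralLevel 2 K) (π : CuspidalAutomorphicRepData 2 K hcpt),
            IsPiOfArtinRep (modThreeLift ρ) π.1) →
        ModPImageAbsIrreducibleOverCyclotomic (E.baseChange K) 3 → IsAutomorphicOfWeightZero E)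
    (h2 : ∀ (K : Type) [Field K] [NumberField K] [IsTotallyReal K] (E : WeierstrassCurve (𝓞 K)),
      E.Δ ≠ 0 → ∀ (p : ℕ) [Fact p.Prime], p = 5 →
        (∃ E' : WeierstrassCurve (𝓞 K), E'.Δ ≠ 0 ∧ IsAutomorphicOfWeightZero E' ∧
          ∃ ρ : ModPGaloisRep K (ZMod p) 2,
            (E.baseChange K).IsTorsionGaloisRep p ρ ∧ (E'.baseChange K).IsTorsionGaloisRep p ρ) →
        ModPImageAbsIrreducibleOverCyclotomic (E.baseChange K) p → IsAutomorphicOfWeightZero E)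
    (h61 : ∀ (K : Type) [Field K] [NumberField K] (E : WeierstrassCurve (𝓞 K)), E.Δ ≠ 0 →
      ∃ E' : WeierstrassCurve (𝓞 K), E'.Δ ≠ 0 ∧
        (∃ ρ : ModPGaloisRep K (ZMod 5) 2,
          (E.baseChange K).IsTorsionGaloisRep 5 ρ ∧ (E'.baseChange K).IsTorsionGaloisRep 5 ρ) ∧
        ∃ ρ₃ : FramedGaloisRep K (ZMod 3) 2, (E'.baseChange K).IsTorsionGaloisRep 3 ρ₃ ∧
          ∀ g : Matrix.SpecialLinearGroup (Fin 2) (ZMod 3), ∃ σ,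
            ρ₃ σ = Matrix.SpecialLinearGroup.toGL g) :
    FLS2015_theorem3 :=
  FLS2015_theorem3_of_corollary5_1_of_switching
    (fun K _ _ _ E hΔ p _ hp himg => by
      subst hp
      exact h3 K E hΔ
        (fun ρ hρ => FLS2015.exists_isPiOfArtinRep_modThreeLift hSA ρ
          (himg.isAbsolutelyIrreducible hρ))
        himg)
    h2 h61

/-- **`Thorne2019_thm2_five` closed modulo `strongArtin_of_isSolvable` and the carrier-less
inputs `h3`, `h2`, `h61`, `hT`**: `Thorne2019_thm2_five_of_switching_of_dihedralLifting` with its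
input `h51` split exactly as in `FLS2015_theorem3_of_strongArtin_of_liftingAtThree_of_switching`
(Langlands–Tunnell step discharged from the existing fact; the rest of Cor. 5.1 kept as `h3`).
[cite: Thorne2019, Thm. 2 and its proof] [cite: Thorne2016, Thms. 7.5, 7.6]
[cite: FreitasLeHungSiksek2015, Cor. 5.1, Thm. 6, Thm. 2, Lemma 6.1] [cite: Gelbart1997, Thm. 2.1] -/
theorem Thorne2019_thm2_five_of_strongArtin_of_liftingAtThree_of_switching_of_dihedralLifting
    (hSA : strongArtin_of_isSolvable)
    (h3 : ∀ (K : Type) [Field K] [NumberField K] [IsTotallyReal K] (E : WeierstrassCurve (𝓞 K)),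
      E.Δ ≠ 0 →
        (∀ ρ : ModPGaloisRep K (ZMod 3) 2, (E.baseChange K).IsTorsionGaloisRep 3 ρ →
          ∃ (hcpt : isCompact_glFiniteIntegralLevel 2 K) (π : CuspidalAutomorphicRepData 2 K hcpt),
            IsPiOfArtinRep (modThreeLift ρ) π.1) →
        ModPImageAbsIrreducibleOverCyclotomic (E.baseChange K) 3 → IsAutomorphicOfWeightZero E)
    (h2 : ∀ (K : Type) [Field K] [NumberField K] [IsTotallyReal K] (E : WeierstrassCurve (𝓞 K)),
      E.Δ ≠ 0 → ∀ (p : ℕ) [Fact p.Prime], p = 5 →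
        (∃ E' : WeierstrassCurve (𝓞 K), E'.Δ ≠ 0 ∧ IsAutomorphicOfWeightZero E' ∧
          ∃ ρ : ModPGaloisRep K (ZMod p) 2,
            (E.baseChange K).IsTorsionGaloisRep p ρ ∧ (E'.baseChange K).IsTorsionGaloisRep p ρ) →
        ModPImageAbsIrreducibleOverCyclotomic (E.baseChange K) p → IsAutomorphicOfWeightZero E)
    (h61 : ∀ (K : Type) [Field K] [NumberField K] (E : WeierstrassCurve (𝓞 K)), E.Δ ≠ 0 →
      ∃ E' : WeierstrassCurve (𝓞 K), E'.Δ ≠ 0 ∧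
        (∃ ρ : ModPGaloisRep K (ZMod 5) 2,
          (E.baseChange K).IsTorsionGaloisRep 5 ρ ∧ (E'.baseChange K).IsTorsionGaloisRep 5 ρ) ∧
        ∃ ρ₃ : FramedGaloisRep K (ZMod 3) 2, (E'.baseChange K).IsTorsionGaloisRep 3 ρ₃ ∧
          ∀ g : Matrix.SpecialLinearGroup (Fin 2) (ZMod 3), ∃ σ,
            ρ₃ σ = Matrix.SpecialLinearGroup.toGL g)
    (hT : ∀ (F : Type) [Field F] [NumberField F] [IsTotallyReal F], ¬ IsSquare (5 : F) →
      ∀ (p : ℕ) [Fact p.Prime], p = 5 →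
        ∀ (E : WeierstrassCurve (𝓞 F)), E.Δ ≠ 0 → (E.baseChange F).HasIrreducibleModPGaloisRep 5 →
          ∀ ρ : ModPGaloisRep F (ZMod p) 2, (E.baseChange F).IsTorsionGaloisRep p ρ →
            FramedRep.IsAbsolutelyIrreducible ρ →
            (∀ σ, Matrix.GeneralLinearGroup.det (ρ σ) = modPCyclotomicCharacterZMod F p σ) →
            ∀ (L : Type) [Field L] [Algebra F L] [IsCyclotomicExtension {p} F L],
              ¬ FramedRep.IsAbsolutelyIrreducible (FramedGaloisRep.restrictField L ρ) →
              (∃ (k : Type) (_ : Field k) (f : ZMod p →+* k) (Q : GL (Fin 2) k),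
                  (∀ τ : absoluteGaloisGroup L,
                    Q * Matrix.GeneralLinearGroup.map f (FramedGaloisRep.restrictField L ρ τ) *
                      Q⁻¹ ∈ Serre1972.diagonalSubgroup k) ∧
                  ∃ τ : absoluteGaloisGroup L,
                    ((Q * Matrix.GeneralLinearGroup.map f (FramedGaloisRep.restrictField L ρ τ) *
                        Q⁻¹ : GL (Fin 2) k) : Matrix (Fin 2) (Fin 2) k) 0 0 ≠
                      ((Q * Matrix.GeneralLinearGroup.map f (FramedGaloisRep.restrictField L ρ τ) *
                        Q⁻¹ : GL (Fin 2) k) : Matrix (Fin 2) (Fin 2) k) 1 1) →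
              (∃ (M : Type) (_ : Field M) (_ : Algebra F M),
                  Module.finrank F M = 2 ∧ IsTotallyReal M ∧ Nonempty (M →ₐ[F] L)) →
              IsAutomorphicOfWeightZero E) :
    Thorne2019_thm2_five :=
  Thorne2019_thm2_five_of_switching_of_dihedralLifting
    (fun K _ _ _ E hΔ p _ hp himg => by
      subst hp
      exact h3 K E hΔ
        (fun ρ hρ => FLS2015.exists_isPiOfArtinRep_modThreeLift hSA ρ
          (himg.isAbsolutelyIrreducible hρ))
        himg)
    h2 h61 hT

/-! ## The two vendored carriers of FLS Thms. 3–4 are the same statement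

The printed Theorems 3 and 4 are carried twice in the tree: separately, as `FLS2015_theorem3`
(`p = 3 ∨ p = 5`) and `FLS2015_theorem4` (`p = 7`) in `FLSResidualImageCriteria.lean`, and jointly,
as `FLS2015_theorems3_4` (`p = 3 ∨ p = 5 ∨ p = 7`) in `FreitasLeHungSiksekLifting.lean` (the carrier
grounding route `SqrtFiveQuarticCovers`, declared there its "canonical home").  All three live on the
same carriers (`IsAutomorphicOfWeightZero`, `ModPImageAbsIrreducibleOverCyclotomic`), so the joint
fact is LITERALLY the conjunction of the two separate ones; the equivalence is recorded here, in the
proofs file of `FLS2015_theorem3`, so that a discharge of either side discharges the other by a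
one-liner and the debt is counted once (`FLS2015.largeImage_of_theorem3_theorem4` is the forward
direction with the joint statement unfolded). -/

/-- `FLS2015_theorems3_4` (joint carrier, `p ∈ {3, 5, 7}`) from `FLS2015_theorem3` (`p ∈ {3, 5}`)
and `FLS2015_theorem4` (`p = 7`): `FLS2015.largeImage_of_theorem3_theorem4`, restated with the
joint named fact as conclusion. [cite: FreitasLeHungSiksek2015, Thm. 3 and Thm. 4] -/
theorem FLS2015_theorems3_4_of_theorem3_of_theorem4 (h3 : FLS2015_theorem3)
    (h4 : FLS2015_theorem4) : FLS2015_theorems3_4 :=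
  fun K _ _ _ E hΔ p _ hp himg => FLS2015.largeImage_of_theorem3_theorem4 h3 h4 K E hΔ p hp himg

/-- `FLS2015_theorem3` (`p = 3 ∨ p = 5`) is the `p ≠ 7` part of the joint carrier
`FLS2015_theorems3_4`. [cite: FreitasLeHungSiksek2015, Thm. 3] -/
theorem FLS2015_theorem3_of_theorems3_4 (h : FLS2015_theorems3_4) : FLS2015_theorem3 :=
  fun K _ _ _ E hΔ p _ hp himg => h K E hΔ p (hp.elim Or.inl fun h5 => Or.inr (Or.inl h5)) himg

/-- `FLS2015_theorem4` (`p = 7`) is the `p = 7` part of the joint carrier `FLS2015_theorems3_4`.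
[cite: FreitasLeHungSiksek2015, Thm. 4] -/
theorem FLS2015_theorem4_of_theorems3_4 (h : FLS2015_theorems3_4) : FLS2015_theorem4 :=
  fun K _ _ _ E hΔ p _ hp himg => h K E hΔ p (Or.inr (Or.inr hp)) himg

/-- **The joint carrier `FLS2015_theorems3_4` is equivalent to `FLS2015_theorem3 ∧ FLS2015_theorem4`.**
[cite: FreitasLeHungSiksek2015, Thm. 3 and Thm. 4] -/
theorem FLS2015_theorems3_4_iff : FLS2015_theorems3_4 ↔ FLS2015_theorem3 ∧ FLS2015_theorem4 :=
  ⟨fun h => ⟨FLS2015_theorem3_of_theorems3_4 h, FLS2015_theorem4_of_theorems3_4 h⟩,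
    fun h => FLS2015_theorems3_4_of_theorem3_of_theorem4 h.1 h.2⟩

/-- **The joint carrier closed modulo the same primitive inputs as `FLS2015_theorem3`, plus
`FLS2015_theorem4`**: `FLS2015_theorems3_4` from `strongArtin_of_isSolvable`, the carrier-less
printed inputs `h3` (rest of Cor. 5.1), `h2` (Thm. 2 at `p = 5`), `h61` (Lemma 6.1) of
`FLS2015_theorem3_of_strongArtin_of_liftingAtThree_of_switching`, and the named fact
`FLS2015_theorem4` (the `3–7` switching of §7, not analysed in this file).
[cite: FreitasLeHungSiksek2015, Thms. 3–4, Cor. 5.1, Thm. 6, Thm. 2, Lemma 6.1]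
[cite: Gelbart1997, Thm. 2.1] -/
theorem FLS2015_theorems3_4_of_strongArtin_of_liftingAtThree_of_switching_of_theorem4
    (hSA : strongArtin_of_isSolvable)
    (h3 : ∀ (K : Type) [Field K] [NumberField K] [IsTotallyReal K] (E : WeierstrassCurve (𝓞 K)),
      E.Δ ≠ 0 →
        (∀ ρ : ModPGaloisRep K (ZMod 3) 2, (E.baseChange K).IsTorsionGaloisRep 3 ρ →
          ∃ (hcpt : isCompact_glFiniteIntegralLevel 2 K) (π : CuspidalAutomorphicRepData 2 K hcpt),
            IsPiOfArtinRep (modThreeLift ρ) π.1) →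
        ModPImageAbsIrreducibleOverCyclotomic (E.baseChange K) 3 → IsAutomorphicOfWeightZero E)
    (h2 : ∀ (K : Type) [Field K] [NumberField K] [IsTotallyReal K] (E : WeierstrassCurve (𝓞 K)),
      E.Δ ≠ 0 → ∀ (p : ℕ) [Fact p.Prime], p = 5 →
        (∃ E' : WeierstrassCurve (𝓞 K), E'.Δ ≠ 0 ∧ IsAutomorphicOfWeightZero E' ∧
          ∃ ρ : ModPGaloisRep K (ZMod p) 2,
            (E.baseChange K).IsTorsionGaloisRep p ρ ∧ (E'.baseChange K).IsTorsionGaloisRep p ρ) →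
        ModPImageAbsIrreducibleOverCyclotomic (E.baseChange K) p → IsAutomorphicOfWeightZero E)
    (h61 : ∀ (K : Type) [Field K] [NumberField K] (E : WeierstrassCurve (𝓞 K)), E.Δ ≠ 0 →
      ∃ E' : WeierstrassCurve (𝓞 K), E'.Δ ≠ 0 ∧
        (∃ ρ : ModPGaloisRep K (ZMod 5) 2,
          (E.baseChange K).IsTorsionGaloisRep 5 ρ ∧ (E'.baseChange K).IsTorsionGaloisRep 5 ρ) ∧
        ∃ ρ₃ : FramedGaloisRep K (ZMod 3) 2, (E'.baseChange K).IsTorsionGaloisRep 3 ρ₃ ∧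
          ∀ g : Matrix.SpecialLinearGroup (Fin 2) (ZMod 3), ∃ σ,
            ρ₃ σ = Matrix.SpecialLinearGroup.toGL g)
    (h4 : FLS2015_theorem4) : FLS2015_theorems3_4 :=
  FLS2015_theorems3_4_of_theorem3_of_theorem4
    (FLS2015_theorem3_of_strongArtin_of_liftingAtThree_of_switching hSA h3 h2 h61) h4

/-! ## Theorem 3 from Theorem 6, Theorem 2 (both verbatim, on `ModPGaloisRep.IsHilbertModular`)
and Lemma 6.1

With the carrier `ModPGaloisRep.IsHilbertModular` ("`ρ̄` is modular", FLS §1;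
`HilbertResidualModularity.lean`) the two lifting inputs of the printed proof can be written as
printed, instead of in the ad-hoc forms `h51`/`h3` and `h2` above:
* `h6` — **Theorem 6** (§5, Langlands–Tunnell after Dieulefait–Freitas): "Let `E` be an elliptic
  curve over a totally real number field `K` and suppose `ρ̄_{E,3}` is irreducible. Then `ρ̄_{E,3}`
  is modular" — for every framing `ρ̄` of `E[3]`, `ρ̄` irreducible ⇒ `ρ̄.IsHilbertModular`;
* `h2` — **Theorem 2** (§1 p. 4, §2): "Let `E` be an elliptic curve over a totally real number
  field `K`, and let `p ≠ 2` be a rational prime. Write `ρ̄ = ρ̄_{E,p}`. Suppose (i) `ρ̄` is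
  modular, (ii) `ρ̄(G_{K(ζ_p)})` is absolutely irreducible. Then `E` is modular" — with (i) as
  "every framing of `E[p]` is modular" (equivalently some framing,
  `IsTorsionGaloisRep.isHilbertModular_of_isTorsionGaloisRep`) and (ii) as
  `ModPImageAbsIrreducibleOverCyclotomic`.
Both are hypotheses (no carrier-less statement is turned into a named fact, D-0026); the theorems
below show that they imply the forms `h51`, `h2` consumed by every assembly above, so that all of
them — and `FLS2015_theorem3` — are now closed modulo the two lifting theorems AS PRINTED, the
switching Lemma 6.1, and (for Thm. 6 split at its Langlands–Tunnell seam) the existing fact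
`strongArtin_of_isSolvable` plus the weight-one-to-weight-two step of [DF2]. -/

/-- **Corollary 5.1 = Theorem 6 + Theorem 2 at `p = 3`** ("This is an immediate corollary of
Langlands–Tunnell and Theorem 2. It is of course Theorem 3 with `p = 3`", §5): for `E / 𝓞 K`
(`K` totally real, `Δ ≠ 0`) with `ρ̄_{E,3}(G_{K(ζ₃)})` absolutely irreducible, every framing `ρ̄`
of `E[3]` is absolutely irreducible (`ModPImageAbsIrreducibleOverCyclotomic.isAbsolutelyIrreducible`),
hence irreducible, hence modular by Thm. 6 (`h6`); so hypothesis (i) of Thm. 2 (`h2`, `p = 3 ≠ 2`)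
holds and `E` is modular.  The conclusion is literally the binder `h51` of the assemblies above.
[cite: FreitasLeHungSiksek2015, Cor. 5.1 (§5), Thm. 6, Thm. 2] -/
theorem FLS2015.corollary5_1_of_theorem6_of_theorem2
    (h6 : ∀ (K : Type) [Field K] [NumberField K] [IsTotallyReal K] (E : WeierstrassCurve (𝓞 K)),
      E.Δ ≠ 0 → ∀ ρ : ModPGaloisRep K (ZMod 3) 2, (E.baseChange K).IsTorsionGaloisRep 3 ρ →
        FramedRep.IsIrreducible ρ → ρ.IsHilbertModular)
    (h2 : ∀ (K : Type) [Field K] [NumberField K] [IsTotallyReal K] (E : WeierstrassCurve (𝓞 K)),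
      E.Δ ≠ 0 → ∀ (p : ℕ) [Fact p.Prime], p ≠ 2 →
        (∀ ρ : ModPGaloisRep K (ZMod p) 2, (E.baseChange K).IsTorsionGaloisRep p ρ →
          ρ.IsHilbertModular) →
        ModPImageAbsIrreducibleOverCyclotomic (E.baseChange K) p → IsAutomorphicOfWeightZero E)
    (K : Type) [Field K] [NumberField K] [IsTotallyReal K] (E : WeierstrassCurve (𝓞 K))
    (hΔ : E.Δ ≠ 0) (p : ℕ) [Fact p.Prime] (hp : p = 3)
    (himg : ModPImageAbsIrreducibleOverCyclotomic (E.baseChange K) p) :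
    IsAutomorphicOfWeightZero E := by
  subst hp
  exact h2 K E hΔ 3 (by decide)
    (fun ρ hρ => h6 K E hΔ ρ hρ (himg.isAbsolutelyIrreducible hρ).isIrreducible) himg

/-- **Theorem 2 (verbatim) implies the form in which the switching arguments use it**: if
`E[5] ≅ E′[5]` (one common framing `ρ̄₀`) for a MODULAR `E′ / 𝓞 K` (`Δ(E′) ≠ 0`,
`IsAutomorphicOfWeightZero E′`), then every framing `ρ̄` of `E[5]` is modular — `ρ̄₀` is, as a
framing of `E′[5]` (`IsTorsionGaloisRep.isHilbertModular`: "Thus `ρ̄_{E,5} ∼ ρ̄_{E′,5}` is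
modular", §6), and `ρ̄` is conjugate to `ρ̄₀` (`IsTorsionGaloisRep.isHilbertModular_of_isTorsionGaloisRep`)
— so Thm. 2 at `p = 5` applies.  The conclusion is literally the binder `h2` of the assemblies above.
[cite: FreitasLeHungSiksek2015, Thm. 2 and §6 (proof of Thm. 3 for p = 5)] -/
theorem FLS2015.liftingAtFive_of_theorem2
    (h2 : ∀ (K : Type) [Field K] [NumberField K] [IsTotallyReal K] (E : WeierstrassCurve (𝓞 K)),
      E.Δ ≠ 0 → ∀ (p : ℕ) [Fact p.Prime], p ≠ 2 →
        (∀ ρ : ModPGaloisRep K (ZMod p) 2, (E.baseChange K).IsTorsionGaloisRep p ρ →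
          ρ.IsHilbertModular) →
        ModPImageAbsIrreducibleOverCyclotomic (E.baseChange K) p → IsAutomorphicOfWeightZero E)
    (K : Type) [Field K] [NumberField K] [IsTotallyReal K] (E : WeierstrassCurve (𝓞 K))
    (hΔ : E.Δ ≠ 0) (p : ℕ) [Fact p.Prime] (hp : p = 5)
    (hE' : ∃ E' : WeierstrassCurve (𝓞 K), E'.Δ ≠ 0 ∧ IsAutomorphicOfWeightZero E' ∧
      ∃ ρ : ModPGaloisRep K (ZMod p) 2,
        (E.baseChange K).IsTorsionGaloisRep p ρ ∧ (E'.baseChange K).IsTorsionGaloisRep p ρ)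
    (himg : ModPImageAbsIrreducibleOverCyclotomic (E.baseChange K) p) :
    IsAutomorphicOfWeightZero E := by
  subst hp
  obtain ⟨E', hΔ', hE', ρ₀, hρ₀, hρ₀'⟩ := hE'
  exact h2 K E hΔ 5 (by decide)
    (fun ρ hρ => hρ.isHilbertModular_of_isTorsionGaloisRep hρ₀ (hρ₀'.isHilbertModular hΔ' hE'))
    himg

/-- **`FLS2015_theorem3` from Theorem 6, Theorem 2 (as printed) and Lemma 6.1** — the printed
proof of Thm. 3 in full: `p = 3` is Cor. 5.1 (`FLS2015.corollary5_1_of_theorem6_of_theorem2`);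
`p = 5` is the `3–5` switch of §6 (`FLS2015.theorem3_five_of_switching`) fed with Cor. 5.1 and with
Thm. 2 at `p = 5` in the verbatim form (`FLS2015.liftingAtFive_of_theorem2`).  The three
hypotheses are the primitive published inputs of the source (modularity lifting — Breuil–Diamond
Thm. 3.2.2 / Kisin / Gee / BLGG; Langlands–Tunnell over `K` with the weight shift of [DF2];
`X_E(5) ≅ ℙ¹` and Hilbert irreducibility); none has a carrier in the tree and none is minted here
(D-0026).  [cite: FreitasLeHungSiksek2015, Thm. 3 and its proof (Cor. 5.1, §6), Thm. 2, Thm. 6, Lemma 6.1] -/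
theorem FLS2015_theorem3_of_theorem6_of_theorem2_of_switching
    (h6 : ∀ (K : Type) [Field K] [NumberField K] [IsTotallyReal K] (E : WeierstrassCurve (𝓞 K)),
      E.Δ ≠ 0 → ∀ ρ : ModPGaloisRep K (ZMod 3) 2, (E.baseChange K).IsTorsionGaloisRep 3 ρ →
        FramedRep.IsIrreducible ρ → ρ.IsHilbertModular)
    (h2 : ∀ (K : Type) [Field K] [NumberField K] [IsTotallyReal K] (E : WeierstrassCurve (𝓞 K)),
      E.Δ ≠ 0 → ∀ (p : ℕ) [Fact p.Prime], p ≠ 2 →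
        (∀ ρ : ModPGaloisRep K (ZMod p) 2, (E.baseChange K).IsTorsionGaloisRep p ρ →
          ρ.IsHilbertModular) →
        ModPImageAbsIrreducibleOverCyclotomic (E.baseChange K) p → IsAutomorphicOfWeightZero E)
    (h61 : ∀ (K : Type) [Field K] [NumberField K] (E : WeierstrassCurve (𝓞 K)), E.Δ ≠ 0 →
      ∃ E' : WeierstrassCurve (𝓞 K), E'.Δ ≠ 0 ∧
        (∃ ρ : ModPGaloisRep K (ZMod 5) 2,
          (E.baseChange K).IsTorsionGaloisRep 5 ρ ∧ (E'.baseChange K).IsTorsionGaloisRep 5 ρ) ∧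
        ∃ ρ₃ : FramedGaloisRep K (ZMod 3) 2, (E'.baseChange K).IsTorsionGaloisRep 3 ρ₃ ∧
          ∀ g : Matrix.SpecialLinearGroup (Fin 2) (ZMod 3), ∃ σ,
            ρ₃ σ = Matrix.SpecialLinearGroup.toGL g) :
    FLS2015_theorem3 :=
  FLS2015_theorem3_of_corollary5_1_of_switching (FLS2015.corollary5_1_of_theorem6_of_theorem2 h6 h2)
    (FLS2015.liftingAtFive_of_theorem2 h2) h61

/-- **`FLS2015_theorem3` closed modulo `strongArtin_of_isSolvable`, the weight shift of Thm. 6,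
Thm. 2 (as printed) and Lemma 6.1.**  Theorem 6 is split at the seam the tree expresses: its
Langlands–Tunnell step — `π(Ψ ∘ ρ̄)` exists on `GL₂(𝔸_K)` for every irreducible framing `ρ̄` of
`E[3]` — is DISCHARGED from the existing named fact `strongArtin_of_isSolvable`
(`WeierstrassCurve.exists_isPiOfArtinRep_modThreeLift_of_strongArtin`), and what remains of Thm. 6 is
the hypothesis `hW2`: the weight-one cuspidal `π(Ψ ∘ ρ̄_{E,3})` yields a Hilbert eigenform of
parallel weight two congruent to `ρ̄_{E,3}`, i.e. "`ρ̄_{E,3}` is modular" (`IsHilbertModular`) —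
in print [DF2] following Wiles: multiply by an Eisenstein series `≡ 1 (mod 3)` of parallel weight
one and apply the Deligne–Serre lemma (no carrier in the tree: Hilbert modular forms with
`q`-expansions).  [cite: FreitasLeHungSiksek2015, Thm. 6 (§5) and its deduction, Thm. 2, Lemma 6.1, Thm. 3]
[cite: Gelbart1997, Thm. 2.1 and §1.4] -/
theorem FLS2015_theorem3_of_strongArtin_of_weightTwo_of_theorem2_of_switching
    (hSA : strongArtin_of_isSolvable)
    (hW2 : ∀ (K : Type) [Field K] [NumberField K] [IsTotallyReal K] (E : WeierstrassCurve (𝓞 K)),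
      E.Δ ≠ 0 → ∀ ρ : ModPGaloisRep K (ZMod 3) 2, (E.baseChange K).IsTorsionGaloisRep 3 ρ →
        (∃ (hcpt : isCompact_glFiniteIntegralLevel 2 K) (π : CuspidalAutomorphicRepData 2 K hcpt),
            IsPiOfArtinRep (modThreeLift ρ) π.1) → ρ.IsHilbertModular)
    (h2 : ∀ (K : Type) [Field K] [NumberField K] [IsTotallyReal K] (E : WeierstrassCurve (𝓞 K)),
      E.Δ ≠ 0 → ∀ (p : ℕ) [Fact p.Prime], p ≠ 2 →
        (∀ ρ : ModPGaloisRep K (ZMod p) 2, (E.baseChange K).IsTorsionGaloisRep p ρ →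
          ρ.IsHilbertModular) →
        ModPImageAbsIrreducibleOverCyclotomic (E.baseChange K) p → IsAutomorphicOfWeightZero E)
    (h61 : ∀ (K : Type) [Field K] [NumberField K] (E : WeierstrassCurve (𝓞 K)), E.Δ ≠ 0 →
      ∃ E' : WeierstrassCurve (𝓞 K), E'.Δ ≠ 0 ∧
        (∃ ρ : ModPGaloisRep K (ZMod 5) 2,
          (E.baseChange K).IsTorsionGaloisRep 5 ρ ∧ (E'.baseChange K).IsTorsionGaloisRep 5 ρ) ∧
        ∃ ρ₃ : FramedGaloisRep K (ZMod 3) 2, (E'.baseChange K).IsTorsionGaloisRep 3 ρ₃ ∧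
          ∀ g : Matrix.SpecialLinearGroup (Fin 2) (ZMod 3), ∃ σ,
            ρ₃ σ = Matrix.SpecialLinearGroup.toGL g) :
    FLS2015_theorem3 :=
  FLS2015_theorem3_of_theorem6_of_theorem2_of_switching
    (fun K _ _ _ E hΔ ρ hρ hirr => by
      haveI := FLS2015.isElliptic_baseChange hΔ
      exact hW2 K E hΔ ρ hρ
        ((E.baseChange K).exists_isPiOfArtinRep_modThreeLift_of_strongArtin hSA hρ hirr))
    h2 h61

/-- **`Thorne2019_thm2_five` from Theorem 6, Theorem 2 (as printed), Lemma 6.1 and Thorne 2016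
Thm. 7.5**: `Thorne2019_thm2_five_of_switching_of_dihedralLifting` with its FLS inputs `h51`, `h2`
derived from the verbatim Thms. 6 and 2 (`FLS2015.corollary5_1_of_theorem6_of_theorem2`,
`FLS2015.liftingAtFive_of_theorem2`); `hT` is the binder of `Thorne2019_thm2_five_of_liftingAtFive`.
[cite: Thorne2019, Thm. 2 and its proof] [cite: Thorne2016, Thms. 7.5, 7.6]
[cite: FreitasLeHungSiksek2015, Thm. 6, Thm. 2, Lemma 6.1] -/
theorem Thorne2019_thm2_five_of_theorem6_of_theorem2_of_switching_of_dihedralLifting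
    (h6 : ∀ (K : Type) [Field K] [NumberField K] [IsTotallyReal K] (E : WeierstrassCurve (𝓞 K)),
      E.Δ ≠ 0 → ∀ ρ : ModPGaloisRep K (ZMod 3) 2, (E.baseChange K).IsTorsionGaloisRep 3 ρ →
        FramedRep.IsIrreducible ρ → ρ.IsHilbertModular)
    (h2 : ∀ (K : Type) [Field K] [NumberField K] [IsTotallyReal K] (E : WeierstrassCurve (𝓞 K)),
      E.Δ ≠ 0 → ∀ (p : ℕ) [Fact p.Prime], p ≠ 2 →
        (∀ ρ : ModPGaloisRep K (ZMod p) 2, (E.baseChange K).IsTorsionGaloisRep p ρ →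
          ρ.IsHilbertModular) →
        ModPImageAbsIrreducibleOverCyclotomic (E.baseChange K) p → IsAutomorphicOfWeightZero E)
    (h61 : ∀ (K : Type) [Field K] [NumberField K] (E : WeierstrassCurve (𝓞 K)), E.Δ ≠ 0 →
      ∃ E' : WeierstrassCurve (𝓞 K), E'.Δ ≠ 0 ∧
        (∃ ρ : ModPGaloisRep K (ZMod 5) 2,
          (E.baseChange K).IsTorsionGaloisRep 5 ρ ∧ (E'.baseChange K).IsTorsionGaloisRep 5 ρ) ∧
        ∃ ρ₃ : FramedGaloisRep K (ZMod 3) 2, (E'.baseChange K).IsTorsionGaloisRep 3 ρ₃ ∧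
          ∀ g : Matrix.SpecialLinearGroup (Fin 2) (ZMod 3), ∃ σ,
            ρ₃ σ = Matrix.SpecialLinearGroup.toGL g)
    (hT : ∀ (F : Type) [Field F] [NumberField F] [IsTotallyReal F], ¬ IsSquare (5 : F) →
      ∀ (p : ℕ) [Fact p.Prime], p = 5 →
        ∀ (E : WeierstrassCurve (𝓞 F)), E.Δ ≠ 0 → (E.baseChange F).HasIrreducibleModPGaloisRep 5 →
          ∀ ρ : ModPGaloisRep F (ZMod p) 2, (E.baseChange F).IsTorsionGaloisRep p ρ →
            FramedRep.IsAbsolutelyIrreducible ρ →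
            (∀ σ, Matrix.GeneralLinearGroup.det (ρ σ) = modPCyclotomicCharacterZMod F p σ) →
            ∀ (L : Type) [Field L] [Algebra F L] [IsCyclotomicExtension {p} F L],
              ¬ FramedRep.IsAbsolutelyIrreducible (FramedGaloisRep.restrictField L ρ) →
              (∃ (k : Type) (_ : Field k) (f : ZMod p →+* k) (Q : GL (Fin 2) k),
                  (∀ τ : absoluteGaloisGroup L,
                    Q * Matrix.GeneralLinearGroup.map f (FramedGaloisRep.restrictField L ρ τ) *
                      Q⁻¹ ∈ Serre1972.diagonalSubgroup k) ∧
                  ∃ τ : absoluteGaloisGroup L,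
                    ((Q * Matrix.GeneralLinearGroup.map f (FramedGaloisRep.restrictField L ρ τ) *
                        Q⁻¹ : GL (Fin 2) k) : Matrix (Fin 2) (Fin 2) k) 0 0 ≠
                      ((Q * Matrix.GeneralLinearGroup.map f (FramedGaloisRep.restrictField L ρ τ) *
                        Q⁻¹ : GL (Fin 2) k) : Matrix (Fin 2) (Fin 2) k) 1 1) →
              (∃ (M : Type) (_ : Field M) (_ : Algebra F M),
                  Module.finrank F M = 2 ∧ IsTotallyReal M ∧ Nonempty (M →ₐ[F] L)) →
              IsAutomorphicOfWeightZero E) :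
    Thorne2019_thm2_five :=
  Thorne2019_thm2_five_of_switching_of_dihedralLifting
    (FLS2015.corollary5_1_of_theorem6_of_theorem2 h6 h2) (FLS2015.liftingAtFive_of_theorem2 h2) h61 hT

end Literature.NumberTheory.Automorphic

end
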